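import Literature.Algebra.Homology.PairMapFiltration
import Literature.Algebra.Homology.CoinducedConjugation
import HarnessLib

/-!
# Scalar-type filtrations of pair operators: dévissage with character steps

Topic `Algebra/Homology`; namespace `Literature.Algebra.Homology`.  Definitions with bodies and
theorems; Mathlib + `PairMapFiltration` (the dévissage with TRIVIAL one-dimensional steps) +
`ScalarFiltration`.

`PairMapFiltration.scalarFiltered_sub_of_ambient` filters a triangularisable representation `A` of
`G` by a flag with one-dimensional graded pieces on which `G` acts TRIVIALLY (unipotent `G`).  For
the arithmetic subgroups of a Borel containing units, `G` acts on the graded pieces through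
characters `η_i : G →* kˣ`; this file is the same dévissage with character steps:

* `charRep η` — the one-dimensional representation `k_η`; `pairScalarChar η c a` — the pair map
  "multiplication by `a`" over an endomorphism `c` with `η ∘ c = η`; `pairMapChar` on `Hⁿ(G, k_η)`;
* `scalarFiltered_sub_sup_span_char` — the extension step `W ↦ W + k v` for `v` an
  `η`-eigenvector of `G` and a `χ`-eigenvector of the pair maps modulo `W`;
* `scalarFiltered_sub_of_ambient_char` — **stable subspaces of a representation triangularised by
  vectors `w_i` with diagonal characters `η_i` have scalar-filtered cohomology**, given that the
  pair maps `Hⁿ(c_x, χ_i(x))` on `Hⁿ(G, k_{η_i})` are scalar-filtered.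

[Harder1987, §2, (2.6)–(2.8)] (the weights of the torus on the cohomology of the boundary strata).

## References

* G. Harder, *Eisenstein cohomology of arithmetic groups. The case GL₂*, Invent. Math. 89 (1987), §2.
  [Harder1987]
* K. S. Brown, *Cohomology of Groups*, GTM 87 (1982), III §8. [Brown1982CohomologyGroups]
-/

noncomputable section

open CategoryTheory CategoryTheory.Limits groupCohomology Literature.LinearAlgebra

universe u

namespace Literature.Algebra.Homology

variable {k G : Type u} [Field k] [Group G]

/-! ### One-dimensional characters as representations -/

/-- The representation `g ↦ η(g) · id` of `G` on `k`. [folklore] -/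
def charRepresentation (η : G →* kˣ) : Representation k G k where
  toFun g := ((η g : kˣ) : k) • LinearMap.id
  map_one' := by
    rw [map_one, Units.val_one, one_smul]
    rfl
  map_mul' g h := by
    refine LinearMap.ext fun r => ?_
    simp only [map_mul, Units.val_mul, LinearMap.smul_apply, LinearMap.id_apply, Module.End.mul_apply,
      smul_eq_mul]
    ring

/-- Unfolding `charRepresentation`. [folklore] -/
@[simp]
theorem charRepresentation_apply (η : G →* kˣ) (g : G) (r : k) :
    charRepresentation η g r = (η g : k) * r := rfl

/-- **`k_η`**, the one-dimensional representation with character `η`. [folklore] -/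
abbrev charRep (η : G →* kˣ) : Rep.{u} k G := Rep.of (charRepresentation η)

/-- The pair map "multiplication by `a`" `k_η ∘ c ⟶ k_η` over `c` with `η ∘ c = η`. [folklore] -/
def pairScalarChar (η : G →* kˣ) (c : G →* G) (hηc : ∀ g, η (c g) = η g) (a : k) :
    Rep.res c (charRep η) ⟶ charRep η :=
  Rep.ofHom (LinearMap.intertwiningMap_of_isIntertwiningMap _ _ (a • LinearMap.id) fun g r => by
    change a • ((η (c g) : k) * r) = (η g : k) * (a • r)
    rw [hηc, smul_eq_mul, smul_eq_mul]
    ring)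

/-- Unfolding `pairScalarChar`. [folklore] -/
@[simp]
theorem pairScalarChar_hom_apply (η : G →* kˣ) (c : G →* G) (hηc : ∀ g, η (c g) = η g) (a r : k) :
    (pairScalarChar η c hηc a).hom r = a * r := rfl

/-- **The scaled pair map `Hⁿ(c, a)` on `Hⁿ(G, k_η)`.** [folklore] -/
abbrev pairMapChar (η : G →* kˣ) (c : G →* G) (hηc : ∀ g, η (c g) = η g) (a : k) (n : ℕ) :
    Module.End k (groupCohomology (charRep η) n) :=
  (groupCohomology.map c (pairScalarChar η c hηc a) n).hom

variable (A : Rep.{u} k G) {X : Type*} (c : X → (G →* G)) (φ : ∀ x, Rep.res (c x) A ⟶ A) (S : Set (X → k))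

/-! ### The extension step with a character -/

section Step

variable {A}
variable {W : Submodule k A} (hW : ∀ g, W ≤ W.comap (A.ρ g)) (hφ : ∀ x, ∀ w ∈ W, (φ x).hom w ∈ W)
  (η : G →* kˣ) (v : A) (hvG : ∀ g, A.ρ g v - (η g : k) • v ∈ W) (χ : X → k)
  (hvφ : ∀ x, (φ x).hom v - χ x • v ∈ W)

include hW hvG in
omit S in
/-- `W + k v` is `G`-stable when `v` is an `η`-eigenvector modulo the stable `W`. [folklore] -/
theorem sup_span_stable_char (g : G) : ∀ w' ∈ W ⊔ k ∙ v, A.ρ g w' ∈ W ⊔ k ∙ v := by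
  intro w' hw'
  obtain ⟨w, hw, u, hu, rfl⟩ := Submodule.mem_sup.1 hw'
  obtain ⟨a, rfl⟩ := Submodule.mem_span_singleton.1 hu
  rw [map_add, map_smul,
    show A.ρ g w + a • A.ρ g v = (A.ρ g w + a • (A.ρ g v - (η g : k) • v)) + (a * (η g : k)) • v by
      rw [smul_sub, mul_smul]; abel]
  exact Submodule.add_mem_sup (W.add_mem (hW g hw) (W.smul_mem a (hvG g)))
    (Submodule.smul_mem _ _ (Submodule.mem_span_singleton_self v))

include hW hvG in
omit S in
/-- `G` acts by `η` on `(W + kv)/W`. [folklore] -/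
theorem rho_sub_smul_mem_of_mem_sup_span (g : G) {w' : A} (hw' : w' ∈ W ⊔ k ∙ v) :
    A.ρ g w' - (η g : k) • w' ∈ W := by
  obtain ⟨w, hw, u, hu, rfl⟩ := Submodule.mem_sup.1 hw'
  obtain ⟨a, rfl⟩ := Submodule.mem_span_singleton.1 hu
  rw [map_add, map_smul, show A.ρ g w + a • A.ρ g v - (η g : k) • (w + a • v) =
    (A.ρ g w - (η g : k) • w) + a • (A.ρ g v - (η g : k) • v) by rw [smul_add, smul_sub, smul_comm]; abel]
  exact W.add_mem (W.sub_mem (hW g hw) (W.smul_mem _ hw)) (W.smul_mem a (hvG g))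

include hvG hvφ in
/-- **One-dimensional extension step with a character.**  If `Hⁿ(G, W)` is scalar-filtered with
characters `S`, `v` is an `η`-eigenvector of `G` and a `χ`-eigenvector of the pair maps modulo `W`,
`η ∘ c_x = η`, and the scaled pair maps `Hⁿ(c_x, χ(x))` on `Hⁿ(G, k_η)` are scalar-filtered with
characters in `S`, then `Hⁿ(G, W + kv)` is scalar-filtered with characters `S`.
[cite: Harder1987, §2, (2.6)–(2.8)] -/
theorem scalarFiltered_sub_sup_span_char (hηc : ∀ x g, η (c x g) = η g) (n : ℕ)
    (hgood : ScalarFiltered (pairSubEnd c φ W hW hφ n) S ⊤)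
    (htriv : ScalarFiltered (fun x => pairMapChar η (c x) (hηc x) (χ x) n) S ⊤) :
    ScalarFiltered (pairSubEnd c φ (W ⊔ k ∙ v) (fun g _ hw' => sup_span_stable_char hW η v hvG g _ hw')
      (sup_span_stableφ c φ hφ v χ hvφ) n) S ⊤ := by
  have hle : W ≤ W ⊔ k ∙ v := le_sup_left
  set hW' : ∀ g, W ⊔ k ∙ v ≤ (W ⊔ k ∙ v).comap (A.ρ g) := fun g _ hw' => sup_span_stable_char hW η v hvG g _ hw'
  set hφ' := sup_span_stableφ c φ hφ v χ hvφ
  refine scalarFiltered_sub_of_subQuot c φ S hW hW' hle hφ hφ' n hgood ?_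
  set Q := subQuot A hW hW' with hQ
  have hvmem : v ∈ W ⊔ k ∙ v := Submodule.mem_sup_right (Submodule.mem_span_singleton_self v)
  set q₀ : Q := (subIn A W (W ⊔ k ∙ v)).mkQ ⟨v, hvmem⟩ with hq₀
  have hgenQ : ∀ q : Q, ∃ a : k, q = a • q₀ := by
    intro q
    obtain ⟨w', rfl⟩ := Submodule.mkQ_surjective _ q
    obtain ⟨w, hw, u, hu, hw'⟩ := Submodule.mem_sup.1 w'.2
    obtain ⟨a, rfl⟩ := Submodule.mem_span_singleton.1 hu
    refine ⟨a, ?_⟩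
    rw [hq₀, ← map_smul, ← sub_eq_zero, ← map_sub, Submodule.mkQ_apply, Submodule.Quotient.mk_eq_zero]
    change ((w' : A) - a • v) ∈ W
    rw [← hw', add_sub_cancel_right]
    exact hw
  have hcharQ : ∀ (g : G) (q : Q), Q.ρ g q = (η g : k) • q := by
    intro g q
    obtain ⟨w', rfl⟩ := Submodule.mkQ_surjective _ q
    rw [← sub_eq_zero]
    change (subIn A W (W ⊔ k ∙ v)).mkQ ((subRep A (W ⊔ k ∙ v) hW').ρ g w') -
      (η g : k) • (subIn A W (W ⊔ k ∙ v)).mkQ w' = 0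
    rw [← map_smul, ← map_sub, Submodule.mkQ_apply, Submodule.Quotient.mk_eq_zero]
    exact rho_sub_smul_mem_of_mem_sup_span hW η v hvG g w'.2
  have hφQ : ∀ (x : X) (q : Q), (pairSubQuot (c x) (φ x) hW hW' (hφ x) (hφ' x)).hom q = χ x • q := by
    intro x q
    obtain ⟨w', rfl⟩ := Submodule.mkQ_surjective _ q
    rw [pairSubQuot_hom_apply_mk, ← sub_eq_zero, ← map_smul, ← map_sub, Submodule.mkQ_apply,
      Submodule.Quotient.mk_eq_zero]
    exact phi_sub_smul_mem_of_mem_sup_span c φ hφ v χ hvφ x w'.2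
  by_cases hq0 : q₀ = 0
  · haveI : Subsingleton Q := ⟨fun a b => by
      obtain ⟨a', rfl⟩ := hgenQ a
      obtain ⟨b', rfl⟩ := hgenQ b
      rw [hq0, smul_zero, smul_zero]⟩
    have hQ0 : IsZero Q := (IsZero.iff_id_eq_zero _).2
      (Rep.hom_ext (Representation.IntertwiningMap.ext (LinearMap.ext fun a => Subsingleton.elim _ _)))
    have hz : IsZero (groupCohomology Q n) := (groupCohomology.functor k G n).map_isZero hQ0
    haveI := ModuleCat.subsingleton_of_isZero hz
    rw [show (⊤ : Submodule k (groupCohomology Q n)) = ⊥ from Subsingleton.elim _ _]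
    exact ScalarFiltered.bot
  · set e'ₗ : k →ₗ[k] Q := LinearMap.toSpanSingleton k Q q₀ with he'
    have hinj' : Function.Injective e'ₗ := LinearMap.ker_eq_bot.1 (LinearMap.ker_toSpanSingleton k hq0)
    have hsurj' : Function.Surjective e'ₗ := fun q => by
      obtain ⟨a, rfl⟩ := hgenQ q
      exact ⟨a, LinearMap.toSpanSingleton_apply _ _ _ _⟩
    set E : k ≃ₗ[k] Q := LinearEquiv.ofBijective e'ₗ ⟨hinj', hsurj'⟩ with hE
    have hEsymm : ∀ (g : G) (q : Q), E.symm (Q.ρ g q) = (η g : k) * E.symm q := by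
      intro g q
      rw [hcharQ, map_smul, smul_eq_mul]
    set e : Q ⟶ charRep η := Rep.ofHom (LinearMap.intertwiningMap_of_isIntertwiningMap Q.ρ (charRep η).ρ
      E.symm.toLinearMap fun g q => hEsymm g q) with he
    set e' : charRep η ⟶ Q := Rep.ofHom (LinearMap.intertwiningMap_of_isIntertwiningMap (charRep η).ρ Q.ρ
      E.toLinearMap fun g a => by
        change E ((η g : k) * a) = Q.ρ g (E a)
        rw [hcharQ, ← smul_eq_mul, map_smul]) with he'def
    have hee' : e ≫ e' = 𝟙 Q :=
      Rep.hom_ext (Representation.IntertwiningMap.ext (LinearMap.ext fun q => E.apply_symm_apply q))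
    have hinj : Function.Injective ((groupCohomology.functor k G n).map e).hom := by
      intro a b hab
      have := congrArg ((groupCohomology.functor k G n).map e').hom hab
      change ((groupCohomology.functor k G n).map e ≫ (groupCohomology.functor k G n).map e').hom a =
        ((groupCohomology.functor k G n).map e ≫ (groupCohomology.functor k G n).map e').hom b at this
      rwa [← CategoryTheory.Functor.map_comp, hee', CategoryTheory.Functor.map_id] at this
    have hequiv : ∀ x y, ((groupCohomology.functor k G n).map e).hom
        ((groupCohomology.map (c x) (pairSubQuot (c x) (φ x) hW hW' (hφ x) (hφ' x)) n).hom y) =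
        pairMapChar η (c x) (hηc x) (χ x) n (((groupCohomology.functor k G n).map e).hom y) := by
      intro x y
      have h : groupCohomology.map (c x) (pairSubQuot (c x) (φ x) hW hW' (hφ x) (hφ' x)) n ≫
          groupCohomology.map (MonoidHom.id G) e n =
          groupCohomology.map (MonoidHom.id G) e n ≫
            groupCohomology.map (c x) (pairScalarChar η (c x) (hηc x) (χ x)) n := by
        rw [← groupCohomology.map_comp, ← groupCohomology.map_comp]
        refine map_congr' rfl _ _ (fun q => ?_) n
        change E.symm ((pairSubQuot (c x) (φ x) hW hW' (hφ x) (hφ' x)).hom q) = χ x * E.symm q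
        rw [hφQ, map_smul, smul_eq_mul]
      have := congrArg (fun ψ => ψ.hom y) h
      simp only [ModuleCat.hom_comp, LinearMap.comp_apply] at this
      rw [functor_map_eq]
      exact this
    exact ScalarFiltered.of_injective (T' := fun x => pairMapChar η (c x) (hηc x) (χ x) n)
      ((groupCohomology.functor k G n).map e).hom hinj hequiv htriv

end Step

/-! ### Stable subspaces of a representation triangularised with diagonal characters -/

section Ambient

variable {A}
variable {I : Type*} [Fintype I] (w : I → A) (rank : I → ℕ) (η : I → (G →* kˣ))
  (hwG : ∀ g i, A.ρ g (w i) - (η i g : k) • w i ∈ lowerSpan w rank (rank i))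

include hwG in
omit [Fintype I] in
/-- The flag `lowerSpan` is `G`-stable when `G` acts triangularly on the `w_i`. [folklore] -/
theorem lowerSpan_stable_char (m : ℕ) (g : G) : ∀ v ∈ lowerSpan w rank m, A.ρ g v ∈ lowerSpan w rank m := by
  have h : lowerSpan w rank m ≤ (lowerSpan w rank m).comap (A.ρ g) := by
    rw [lowerSpan, Submodule.span_le]
    rintro _ ⟨j, hj, rfl⟩
    rw [SetLike.mem_coe, Submodule.mem_comap, ← sub_add_cancel (A.ρ g (w j)) ((η j g : k) • w j)]
    exact Submodule.add_mem _ (lowerSpan_mono w rank hj.le (hwG g j))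
      (Submodule.smul_mem _ _ (Submodule.subset_span ⟨j, hj, rfl⟩))
  exact fun v hv => h hv

variable (χ : I → X → k) (hwφ : ∀ x i, (φ x).hom (w i) - χ i x • w i ∈ lowerSpan w rank (rank i))
  (V' : Submodule k A) (hV'G : ∀ g, V' ≤ V'.comap (A.ρ g)) (hV'φ : ∀ x, ∀ v ∈ V', (φ x).hom v ∈ V')

include hwG hV'G in
omit [Fintype I] in
/-- `V' ∩ lowerSpan m` is `G`-stable. [folklore] -/
theorem inf_lowerSpan_stable_char (m : ℕ) (g : G) :
    ∀ v ∈ V' ⊓ lowerSpan w rank m, A.ρ g v ∈ V' ⊓ lowerSpan w rank m := fun _ hv =>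
  ⟨hV'G g hv.1, lowerSpan_stable_char w rank η hwG m g _ hv.2⟩

include hwG hwφ in
/-- **Stable subspaces of a representation triangularised with diagonal characters have
scalar-filtered cohomology.**  Let `w : I → A` be vectors with an injective `rank` on which `G`
acts triangularly with diagonal characters `η_i` and the pair maps `φ_x` act diagonally with
characters `χ_i` modulo lower rank, with `η_i ∘ c_x = η_i`, and such that the scaled pair maps
`Hⁿ(c_x, χ_i(x))` on `Hⁿ(G, k_{η_i})` are scalar-filtered with characters in `S`.  Then for every
`G`- and `φ`-stable subspace `V'` of the span of the `w_i`, `Hⁿ(G, V')` is scalar-filtered with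
characters `S`. [cite: Harder1987, §2, (2.6)–(2.8)] -/
theorem scalarFiltered_sub_of_ambient_char (hrank : Function.Injective rank) (hηc : ∀ i x g, η i (c x g) = η i g)
    (htriv : ∀ i n, ScalarFiltered (fun x => pairMapChar (η i) (c x) (hηc i x) (χ i x) n) S ⊤)
    (hV'le : V' ≤ Submodule.span k (Set.range w)) (n : ℕ) :
    ScalarFiltered (pairSubEnd c φ V' hV'G hV'φ n) S ⊤ := by
  have hst : ∀ (m : ℕ) (g : G), V' ⊓ lowerSpan w rank m ≤ (V' ⊓ lowerSpan w rank m).comap (A.ρ g) :=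
    fun m g _ hv => inf_lowerSpan_stable_char w rank η hwG V' hV'G m g _ hv
  have key : ∀ m : ℕ, ScalarFiltered (pairSubEnd c φ (V' ⊓ lowerSpan w rank m) (hst m)
      (inf_lowerSpan_stableφ c φ w rank χ hwφ V' hV'φ m) n) S ⊤ := by
    intro m
    induction m with
    | zero =>
      have h0 : (⊥ : Submodule k A) = V' ⊓ lowerSpan w rank 0 := by
        refine (eq_bot_iff.2 ?_).symm
        rintro v ⟨-, hv⟩
        have : lowerSpan w rank 0 = ⊥ := by
          rw [lowerSpan, Submodule.span_eq_bot]
          rintro _ ⟨j, hj, rfl⟩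
          exact absurd hj (Nat.not_lt_zero _)
        rw [this] at hv
        exact hv
      exact scalarFiltered_pairSubEnd_congr c φ h0 _ _
        (scalarFiltered_sub_bot c φ S (fun x w hw => by
          rw [(Submodule.mem_bot k).1 hw, map_zero]; exact Submodule.zero_mem _) n)
    | succ m ih =>
      by_cases hex : ∃ i, rank i = m
      · obtain ⟨i, hi⟩ := hex
        set W := V' ⊓ lowerSpan w rank m with hWdef
        have hU : lowerSpan w rank (m + 1) = lowerSpan w rank m ⊔ k ∙ w i :=
          lowerSpan_succ_of_rank_eq w rank hrank hi
        obtain ⟨v, hvW', hW'⟩ := exists_inf_sup_span_eq V' (lowerSpan w rank m) (w i)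
        obtain ⟨u, hu, z, hz, hvz⟩ := Submodule.mem_sup.1 hvW'.2
        obtain ⟨b, rfl⟩ := Submodule.mem_span_singleton.1 hz
        have hvG : ∀ g, A.ρ g v - (η i g : k) • v ∈ W := by
          intro g
          refine ⟨V'.sub_mem (hV'G g hvW'.1) (V'.smul_mem _ hvW'.1), ?_⟩
          rw [← hvz, map_add, map_smul,
            show A.ρ g u + b • A.ρ g (w i) - (η i g : k) • (u + b • w i) =
              (A.ρ g u - (η i g : k) • u) + b • (A.ρ g (w i) - (η i g : k) • w i) by
              rw [smul_add, smul_sub, smul_comm]; abel]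
          exact Submodule.add_mem _ (Submodule.sub_mem _ (lowerSpan_stable_char w rank η hwG m g u hu)
            (Submodule.smul_mem _ _ hu)) (Submodule.smul_mem _ _ (hi ▸ hwG g i))
        have hvφ : ∀ x, (φ x).hom v - χ i x • v ∈ W := by
          intro x
          refine ⟨V'.sub_mem (hV'φ x v hvW'.1) (V'.smul_mem _ hvW'.1), ?_⟩
          rw [← hvz, map_add, map_smul,
            show (φ x).hom u + b • (φ x).hom (w i) - χ i x • (u + b • w i) =
              ((φ x).hom u - χ i x • u) + b • ((φ x).hom (w i) - χ i x • w i) by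
              rw [smul_add, smul_sub, smul_comm]; abel]
          exact Submodule.add_mem _ (Submodule.sub_mem _ (lowerSpan_stableφ c φ w rank χ hwφ m x u hu)
            (Submodule.smul_mem _ _ hu)) (Submodule.smul_mem _ _ (hi ▸ hwφ x i))
        have step := scalarFiltered_sub_sup_span_char c φ S (hst m)
          (inf_lowerSpan_stableφ c φ w rank χ hwφ V' hV'φ m) (η i) v hvG (χ i) hvφ (hηc i) n ih (htriv i n)
        have heq : (V' ⊓ lowerSpan w rank m) ⊔ k ∙ v = V' ⊓ lowerSpan w rank (m + 1) := by rw [hU, hW']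
        exact scalarFiltered_pairSubEnd_congr c φ heq _ _ step
      · push Not at hex
        have heq : V' ⊓ lowerSpan w rank m = V' ⊓ lowerSpan w rank (m + 1) := by
          rw [lowerSpan_succ_of_forall_ne w rank hex]
        exact scalarFiltered_pairSubEnd_congr c φ heq _ _ ih
  have htop : V' ⊓ lowerSpan w rank (Finset.univ.sup rank + 1) = V' :=
    inf_eq_left.2 (hV'le.trans (Submodule.span_le.2 (range_subset_lowerSpan_top w rank)))
  exact scalarFiltered_pairSubEnd_congr c φ htop _ _ (key _)

include hwG hwφ in
/-- The same for an injective equivariant `j : B ↪ A` compatible with the pair maps whose image lies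
in the span of the `w_i`: `Hⁿ(G, B)` is scalar-filtered. [cite: Harder1987, §2, (2.6)–(2.8)] -/
theorem scalarFiltered_of_injective_hom_char (hrank : Function.Injective rank)
    (hηc : ∀ i x g, η i (c x g) = η i g)
    (htriv : ∀ i n, ScalarFiltered (fun x => pairMapChar (η i) (c x) (hηc i x) (χ i x) n) S ⊤)
    {B : Rep.{u} k G} (ψ : ∀ x, Rep.res (c x) B ⟶ B) (j : B ⟶ A) (hj : Function.Injective j.hom)
    (hjψ : ∀ x b, j.hom ((ψ x).hom b) = (φ x).hom (j.hom b))
    (hjle : LinearMap.range j.hom.toLinearMap ≤ Submodule.span k (Set.range w)) (n : ℕ) :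
    ScalarFiltered (fun x => (groupCohomology.map (c x) (ψ x) n).hom) S ⊤ :=
  scalarFiltered_of_injective_hom c φ S ψ j hj hjψ n
    (scalarFiltered_sub_of_ambient_char c φ S w rank η hwG χ hwφ _ (range_stable j)
      (range_stableφ c φ ψ j hjψ) hrank hηc htriv hjle n)

end Ambient

end Literature.Algebra.Homology

end
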